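import Summits.QuantumFields.BalabanUV.Beta.SymLamGroupScaling

/-!
# `BalabanUV.Beta.SymWardLettersAn1Scaled` — binder row D1, chart (III″) supply (leaf-04): THE MIXED WARD LETTERS (T2-M₂) OF an1's `SymWardLettersAn1`
# AT THE κ-WEIGHTED Λ GROUP — `hM₂` for `M2Of 3 Lc (κ • symMixFFAt ρ_c Lc) j` with multiplier pin `κ·cΛ` and remainder `RM := κ • symRMAn1 Lc cΛ`, its row
# classes (the lock letter `hRMp` for the scaled remainder is an2's `SymLamGroupScaling.hRMp_sym_of_lock_smul`, imported BY NAME)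

HONEST FRAMING (cell contract, verbatim): «discharging `BetaPertH` makes Bałaban's UV stability UNCONDITIONAL — a real constructive-QFT
result; it is NOT the continuum limit and NOT the Clay problem.»  THIS MODULE DISCHARGES NOTHING of `BetaPertH` ∕ row D1.  It is the `•`-twin of
an1 g43's `SymWardLettersAn1` §2 (`hM₂_sym`, `vertexFamily_symRMAn1`, `hcls_sym`), consumed BY NAME, over the row OWNER an2 g56's identity kit
`SymLamGroupScaling` (`M1Of_mul_pin`, `M2Of_smul_table`, `hRMp_sym_of_lock_smul` — imported, nothing restated; W-3 l.63100 (D3) «WANTED IN THE REDUCED SHAPE»): [folklore] module algebra,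
0 sorry, 0 def, 0 `def … : Prop`, nothing cited as a fact, no value of any table, NO pin beyond the parent's Λ-lock where the parent has it
(`cΛ`, `κ` are parameters).  The border letters (T2-B) `hBord0_sym ∕ hBord0''_sym ∕ hBordS_sym ∕ hBordS''_sym ∕ hRBp_zero` are κ-FREE (the (III″)
re-weighting touches only the Λ group) and are NOT restated — the chain consumes them from the parent BY NAME.  NOT D1, NOT BetaPertH, NOT continuum,
NOT Clay.

WHY (row D1 ∕ (C1) OWNER an2 g56: RULING R-D1-g56-4 l.62966, `(III″) SPEC v1.0` §4∕§5, A-1 l.63035 «the (III″) Λ group = κ • the (III′) Λ group, κ = Lc¹²∕4;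
remainders = κ • the landed remainders at cΛ₀; twins by `smul` ∕ `parityOdd_smul` ∕ `biLoc_smul`»; leaf-04 g33 census N-1 l.63039: the Λ-lock is
CONSUMED on ROOT M‴'s cone only in `SymWardLettersAn1.hRMp_sym_of_lock` (here) and `CombRemainderTadpoleSlot.lock_of_hΛ` (twin landed in
`SymTablesAn1S2Weighted.weightLock_of_lock`, p392624 ✓)): the Comb chain's step M → MW (`CombChartJointEndReflTablesAn1S2MW` :175–181) instantiates
the root's mixed Ward binders at `RM := symRMAn1 Lc cΛ`, `hM₂ := hM₂_sym cΛ`, `hRMp := hRMp_sym_of_lock hΛ`, `hcls0 ∕ hclsS := hcls_sym …`.  For the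
(III″) literal (record `symTablesAn1S2w 3 Lc (κ·cΛ) κ`, mixed table `κ • symMixFFAt (ctr 4 Lc) Lc`, multiplier pin `κ·cΛ`) this file supplies the
SAME binders at `RM := κ • symRMAn1 Lc cΛ` — so the κ-twin MWw of that step is a one-`exact` re-instantiation.  At `κ = 1` every statement is the
parent's (`one_smul`, `one_mul`).

WHAT:
* **`hM₂_sym_smul (cΛ κ)`** — the binder `hM₂`, every level, every `cΛ κ`: `(stepScale_j·Lc⁴)⁻¹ • Σ_v divV (M2Of 3 Lc (κ • symMixFFAt ρ_c Lc) j · · ρ′ w) (Lc•y+v)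
  = [M1Of … (κ·cΛ) j ρ′ w, D_y] + κ • symRMAn1 Lc cΛ j y ρ′ w` (from `hM₂_sym cΛ` by `smul_sum_divV_smul`, `M1Of_apply`, `comp` bilinearity);
* (the binder `hRMp` for `RM := κ • symRMAn1 Lc cΛ` at the Λ-lock is `SymLamGroupScaling.hRMp_sym_of_lock_smul hΛ κ` — an2's, BY NAME; not restated here;)
* `vertexFamily_symRMAn1_smul`, **`hcls_sym_smul`** — the class binders `hcls0`∕`hclsS` for `RB = RB″ = 0`, `RM := κ • symRMAn1 Lc cΛ` (`biLoc_smul_ff`, constant `|κ|·C`).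
NOT HERE: the chain step MWw itself (the OWNER's word); any pin value (`κ = Lc¹²∕4` appears only as the SPEC's word); any value of any table; the border letters (κ-free, parent's).
HONEST DEPENDENCY (verbatim): «continuum YM on T⁴ ⇐ BetaPertH ∧ nine spine estimates (0/9 proved); BetaPertH ⇐ (D1) ∧ (D4) ∧ CAP+tail;
G-an2-4 gates asym, D1 and NE2/3/4.»  ABSOLUTE RULE (cell, verbatim): «No internally-minted statement may enter as a cited fact. Every
hypothesis is either kernel-proved in this package or a verbatim quotation of a PUBLISHED theorem with page reference.»
Provenance: β sub-cell, D1 formalisation swarm leaf prover 04 (`b2b-balaban-beta-d1-formalise-leaf-04` gen 33), 2026-08-25 (v1 INTENT-2 «SYM-WARD-LETTERS-κ» journal l.63073;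
v2 = the REDUCED SHAPE of the row OWNER's W-3 l.63100 (D3): `hRMp_sym_of_lock_smul` dropped (imported from `SymLamGroupScaling`), slot identities taken
from `SymLamGroupScaling` BY NAME); over an1 g43's `SymWardLettersAn1`, an2 g56's `SymLamGroupScaling`, `SymAveragingHessianCounts.biLoc_smul_ff`,
`KernelReflection.comp_smul_left∕right` BY NAME; no existing file touched.
-/

open Finset
open scoped BigOperators
open Literature.MathematicalPhysics.QuantumFieldTheory
open Literature.MathematicalPhysics.QuantumFieldTheory.Balaban1983to89
open Literature.MathematicalPhysics.QuantumFieldTheory.Balaban1983to89.Beta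
open ExpKernelCalculus (MKer BiLoc VertexFamily comp)
open KernelWard (divV)
open AffineAveraging (box toSite)
open AveragingContoursRooted (ctr ctrOff)
open OneStepResolventKernel (Fib LocStencil)
open BalabanStepW2 (M2Of wM1 wM2)
open Summit.QuantumFields.BalabanUV.Beta.TameKernelCalculus
open Summit.QuantumFields.BalabanUV.Beta.BorderedHessian (diagK stepScale sgnK)
open Summit.QuantumFields.BalabanUV.Beta.AveragingWardRootedStencils (legInd)
open Summit.QuantumFields.BalabanUV.Beta.SpineRooted (M1Of M1Of_apply)
open Summit.QuantumFields.BalabanUV.Beta.SymAveragingHessianCounts (symHessFFAt biLoc_smul_ff)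
open Summit.QuantumFields.BalabanUV.Beta.SymAveragingMixedJetTables (symMixFFAt)
open Summit.QuantumFields.BalabanUV.Beta.SymWardLettersAn1 (symRMAn1 hM₂_sym vertexFamily_symRMAn1 locStencil_zero smul_sum_divV_smul)
open Summit.QuantumFields.BalabanUV.Beta.SymLamGroupScaling (M1Of_mul_pin M2Of_smul_table hRMp_sym_of_lock_smul)

namespace Summit.QuantumFields.BalabanUV.Beta.SymWardLettersAn1Scaled

noncomputable section

variable {Lc : ℕ} [NeZero Lc]

/-! ## §1 (T2-M₂) at the κ-weighted Λ group: the binder `hM₂` with `RM := κ • symRMAn1 Lc cΛ` -/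

/-- [folklore] **(T2-M₂) — THE BINDER `hM₂` AT THE κ-WEIGHTED Λ GROUP, EVERY `cΛ κ`, EVERY LEVEL**: the mixed table `κ • symMixFFAt ρ_c Lc`, the
multiplier pin `κ·cΛ`, the remainder `κ • symRMAn1 Lc cΛ j` — `κ •` the parent's `hM₂_sym cΛ` (the weight leaves the mixed side by `smul_sum_divV_smul`,
`M1Of … (κ·cΛ) = κ • M1Of … cΛ`, and the commutator is linear). -/
theorem hM₂_sym_smul (cΛ κ : ℝ) : ∀ (j : ℕ) (y : Fin 4 → ℤ) (ρ' : Fin 4) (w : Fin 4 → ℤ),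
      (stepScale 3 Lc j * (Lc : ℝ) ^ (3 + 1))⁻¹ •
          ∑ v ∈ box (3 + 1) Lc, divV (fun κ' u => M2Of 3 Lc (κ • symMixFFAt (ctr 4 Lc) Lc) j κ' u ρ' w) ((Lc : ℤ) • y + toSite v) =
        comp (M1Of 3 Lc (symHessFFAt (ctr 4 Lc) Lc) (κ * cΛ) j ρ' w) (diagK ((1 / 2 : ℝ) • ∑ v ∈ box (3 + 1) Lc, legInd (ctr (3 + 1) Lc) ((Lc : ℤ) • y + toSite v)))
          - comp (diagK ((1 / 2 : ℝ) • ∑ v ∈ box (3 + 1) Lc, legInd (ctr (3 + 1) Lc) ((Lc : ℤ) • y + toSite v))) (M1Of 3 Lc (symHessFFAt (ctr 4 Lc) Lc) (κ * cΛ) j ρ' w)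
          + κ • symRMAn1 Lc cΛ j y ρ' w := by
  intro j y ρ' w
  -- the weight leaves the mixed side (`SymLamGroupScaling.M2Of_smul_table`), the pin leaves the multiplier side (`M1Of_mul_pin`)
  have eM2 : (fun κ' u => M2Of 3 Lc (κ • symMixFFAt (ctr 4 Lc) Lc) j κ' u ρ' w) =
      fun κ' u => κ • M2Of 3 Lc (symMixFFAt (ctr 4 Lc) Lc) j κ' u ρ' w := by
    funext κ' u
    exact M2Of_smul_table (Lc := Lc) κ (symMixFFAt (ctr 4 Lc) Lc) j κ' u ρ' w
  have eM1 : M1Of 3 Lc (symHessFFAt (ctr 4 Lc) Lc) (κ * cΛ) j ρ' w = κ • M1Of 3 Lc (symHessFFAt (ctr 4 Lc) Lc) cΛ j ρ' w := by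
    rw [M1Of_mul_pin]; rfl
  have h := hM₂_sym (Lc := Lc) cΛ j y ρ' w
  rw [eM2, smul_sum_divV_smul, eM1, KernelReflection.comp_smul_left, KernelReflection.comp_smul_right, mul_comm, mul_smul, h, smul_add, smul_sub]

/-! ## §2 The remainder's classes (its row parity at the Λ-lock is `SymLamGroupScaling.hRMp_sym_of_lock_smul`) -/

-- (the binder `hRMp` for `RM := κ • symRMAn1 Lc cΛ` at the Λ-lock `cΛ·Lc⁴ = 2`: `SymLamGroupScaling.hRMp_sym_of_lock_smul hΛ κ`, BY NAME)

/-- [folklore] **`κ • symRMAn1 Lc cΛ j` IS A VERTEX FAMILY, CONSTANTS UNIFORM IN THE COARSE SITE** (every level, every `κ`; no hypothesis): `|κ|·C` with the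
parent's `vertexFamily_symRMAn1`. -/
theorem vertexFamily_symRMAn1_smul (hLc : 1 ≤ Lc) (cΛ κ : ℝ) (j : ℕ) :
    ∃ C δ : ℝ, 0 < δ ∧ ∀ y, VertexFamily (κ • symRMAn1 Lc cΛ j y) Lc C δ := by
  obtain ⟨C, δ, hδ, h⟩ := vertexFamily_symRMAn1 (Lc := Lc) hLc cΛ j
  exact ⟨|κ| * C, δ, hδ, fun y ρ' w => biLoc_smul_ff (h y ρ' w) κ⟩

/-- [folklore] **THE CLASS BINDERS `hcls0` (`j = 0`) AND `hclsS j` (level `j+1`) WITH `RB = RB'' = 0`, `RM := κ • symRMAn1 Lc cΛ`** — one rate per level,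
no hypothesis. -/
theorem hcls_sym_smul (hLc : 1 ≤ Lc) (cΛ κ : ℝ) (j : ℕ) : ∃ C δ : ℝ, 0 < δ ∧
    (∀ Y, LocStencil ((0 : ℕ → (Fin 4 → ℤ) → Fin 4 → (Fin 4 → ℤ) → MKer 4 (Fib 3)) j Y) C δ) ∧
    (∀ Y, LocStencil ((0 : ℕ → (Fin 4 → ℤ) → Fin 4 → (Fin 4 → ℤ) → MKer 4 (Fib 3)) j Y) C δ) ∧
    (∀ y, VertexFamily (κ • symRMAn1 Lc cΛ j y) Lc C δ) := by
  obtain ⟨C, δ, hδ, h⟩ := vertexFamily_symRMAn1_smul (Lc := Lc) hLc cΛ κ j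
  have hC : 0 ≤ C := (h 0 0 0).nonneg (Sum.inl 0)
  exact ⟨C, δ, hδ, locStencil_zero hC j, locStencil_zero hC j, h⟩

/-! ## §3 `κ = 1` is the parent -/

/-- [folklore] **AT `κ = 1` THE κ-LETTER `hM₂` IS THE PARENT's STATEMENT** (`one_smul`, `one_mul`) — M‴'s chain is the instance `κ = 1`. -/
theorem hM₂_sym_smul_one (cΛ : ℝ) : ∀ (j : ℕ) (y : Fin 4 → ℤ) (ρ' : Fin 4) (w : Fin 4 → ℤ),
      (stepScale 3 Lc j * (Lc : ℝ) ^ (3 + 1))⁻¹ •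
          ∑ v ∈ box (3 + 1) Lc, divV (fun κ' u => M2Of 3 Lc ((1 : ℝ) • symMixFFAt (ctr 4 Lc) Lc) j κ' u ρ' w) ((Lc : ℤ) • y + toSite v) =
        comp (M1Of 3 Lc (symHessFFAt (ctr 4 Lc) Lc) (1 * cΛ) j ρ' w) (diagK ((1 / 2 : ℝ) • ∑ v ∈ box (3 + 1) Lc, legInd (ctr (3 + 1) Lc) ((Lc : ℤ) • y + toSite v)))
          - comp (diagK ((1 / 2 : ℝ) • ∑ v ∈ box (3 + 1) Lc, legInd (ctr (3 + 1) Lc) ((Lc : ℤ) • y + toSite v))) (M1Of 3 Lc (symHessFFAt (ctr 4 Lc) Lc) (1 * cΛ) j ρ' w)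
          + (1 : ℝ) • symRMAn1 Lc cΛ j y ρ' w :=
  hM₂_sym_smul cΛ 1

end

end Summit.QuantumFields.BalabanUV.Beta.SymWardLettersAn1Scaled
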